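/-
Copyright: statement-level skeleton of a published paper (lit-balaban cell, Phase-2 proof seat p20 gen 5). No proof claims
beyond what the kernel checks below.
-/
import Literature.MathematicalPhysics.QuantumFieldTheory.Balaban1983to89.B3Sect3KernelsZeroTorus
import Literature.MathematicalPhysics.QuantumFieldTheory.Balaban1983to89.B3Ineq326CurlyLocal
import Literature.MathematicalPhysics.QuantumFieldTheory.Balaban1983to89.B3Ineq314Cubes
import Literature.MathematicalPhysics.QuantumFieldTheory.Balaban1983to89.B3Ineq326CurlyCubes

/-!
# B3 — T. Bałaban, *(Higgs)₂,₃ quantum fields in a finite volume. III. Renormalization*, CMP **88** (1983) 411–445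
[Balaban1983Higgs3], pp. 436 and 440 [PDF 26, 30]: the estimates **(3.14)** (localized form of (3.13)) and the p. 440 bound of the
**last curly bracket of (3.26)** WITH THEIR (2.10)-TYPE KERNEL HYPOTHESES DISCHARGED at the zero-field torus model instance

statement-level skeleton of published theorems with citation tags; proofs where landed; nothing here is a claim about the Yang–Mills mass gap

CITATION HEADER (lean-in-tree rule).  Part of the lit-balaban TYPED SKELETON (HOME `run/shared/lean/pub/lit-balaban/`), Phase 2, seat p20
generation 5: rows **B3.Eq3.11-3.17** ((3.14)), **B3.Eq3.25-3.32** ((3.26)) and **B3.Eq2.10** (torus model instance) of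
`HOME/lit-balaban-r15/ROWS-B3.md` (fold owner r15, referee ref-4).  PDF held: `paper:balaban1983-higgs-2-3-quantum-fields-finite-volume`
(journal page = PDF page + 410); pp. 436, 440 read in the OCR text.  Consumes BY NAME: p20 g3's `B3Ineq314Local.abs_term312_le_local`
((3.14) pointwise-local), p20 g3's `B3Ineq326Curly.abs_curly2_le` and p20 g4's `B3Ineq326CurlyLocal.abs_curly2_le_local` ((3.26) last curly
bracket, global-Hölder and localized forms), p20 g5's `B3Ineq314Cubes.abs_term312_le_cubes` / `B3Ineq326CurlyCubes.abs_curly2_le_cubes` (displayed cube forms), and p20 g5's `B3Sect3KernelsZeroTorus.gpiece_bounds` (the four (2.10)-type kernel bounds — value,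
one difference in either variable, mixed difference — of the `η^{−d}`-normalised zero-field torus propagator pieces `gpiece P a msq k j`,
uniformly in the volume, from p03's `B3Ineq210ZeroTorus.ineq210_zeroTorus` and p20's `B3Ineq210MixedTorus.ineq210_mixed_zeroTorus`);
nothing re-proved.

WHAT IS PROVED, and how.  In the landed Sect. 3 estimates the two propagators `G_{(j)}`, `G_{(j′)}` enter only through (2.10)-type
HYPOTHESES (`hGj`, `hGj′`, `hA`, `hA′`, `hB`, `hB′`).  Here those hypotheses are DISCHARGED for the actual propagator pieces of the model at
zero external field on the torus (`Gj := gpiece P a msq k j`, `Gj′ := gpiece P a msq k j′`, `η = ε`, `s = L^jε`, `s′ = L^{j′}ε`), so that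
only the hypotheses on the LEGS (localization functions `|g|, |g′| ≤ 1`, the Hölder / localized (2.11)-type bound on the differentiated leg)
remain:
* `gpiece_bounds_of_le` — the kernel bounds of `gpiece_bounds` at every SMALLER rate `0 < δ′ ≤ δ` (so that a leg bound at its own rate
  `δ₀` can be matched with `δ′ = min δ δ₀`);
* **`abs_term312_le_local_zeroTorus`** — (3.14): `|(3.12)| ≤ 8d·C²C₃Q²e^{δ′/2}(2/δ′+8/δ′²)(m·m^α)Σ_{x,x′}ε^{2d}‖φ(x)‖s^{−d}e^{−½δ′ε|x−x′|₁/s}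
  s′^{2−d}e^{−½δ′ε|x−x′|₁/s′}e^{−½δ′ε|x−x″|₁/s″}` for the torus pieces, every volume, every `1 ≤ k ≤ K`, all `j, j′`;
* **`abs_curly2_le_zeroTorus`** — the p. 440 bound of the last curly bracket of (3.26) under the global Hölder hypothesis on the legs;
* **`abs_curly2_le_local_zeroTorus`** — the same under the localized (2.11)-type leg bound around `x″`;
* **`abs_curly2_le_cubes_zeroTorus`**, **`abs_term312_le_cubes_zeroTorus`** — the same two estimates in their DISPLAYED cube-localized form
  (`B3Ineq326CurlyCubes.abs_curly2_le_cubes`, `B3Ineq314Cubes.abs_term312_le_cubes`: cubes of side `M` lattice units, suprema of the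
  external leg over the cubes, cube distances) for the torus pieces.
The column-difference and mixed hypotheses at swapped arguments (`hA′`, `hB′` of `B3Ineq326Curly`) are the row clauses of `gpiece_bounds`
read through the symmetry of the `ℓ¹` torus distance (`B3Taylor310LocalRemainder.tdist_comm`).

HONEST SCOPE: zero external field (`A = B̃ = 0`, `U ≡ 1`), one real component, the whole torus `T_ε` of side `L^m` and spacing `ε = L^{−K}`
(the scope of `B4Thm110ZeroTorus` / `B3Ineq210ZeroTorus`); general dimension `d ≥ 1` (the constants `δ, C` depend on `d, L, a, m²` only);
both propagators are pieces of the SAME zero-field tower `G_k(T_ε,0)` (scales `j, j′`); the leg hypotheses are kept as printed-type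
hypotheses (they concern the fields, not the propagators).  The pictures (3.12)/(3.17)/(3.27) are not formalized (p18's lane).
Mathlib + the cited tree files only; theorems only, no new definitions, no named facts; standard axioms.
Unit `lit-balaban-p20-g5` (Phase-2 proof seat p20, gen 5), HOME `run/shared/lean/pub/lit-balaban/`, 2026-08-21.
-/

open scoped BigOperators

namespace Literature.MathematicalPhysics.QuantumFieldTheory.Balaban1983to89.B3Sect3EstimatesZeroTorus

open B1RG242Torus B5Display136Torus B3Ineq210ZeroTorus B3Sect3KernelsZeroTorus
open LatticeFieldCalculus B3Sect3ScalarSelfEnergy B3Sect3VectorSelfEnergy B3Taylor310Remainder B3Ineq313Pointwise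
open B3Taylor310LocalRemainder B3Ineq314Local B3Ineq326Curly B3Ineq326CurlyLocal B3Ineq314Cubes B3Ineq326CurlyCubes

noncomputable section

/-! ## §1 The kernel bounds at any smaller rate -/

section Rates

/-- kernel: a (2.10)-type bound at rate `δ` implies the same bound at every rate `δ′ ≤ δ` (`C ≥ 0`, `s > 0`, `u ≥ 0`). [folklore] -/
private theorem relax {δ δ' C p s u v : ℝ} (hC : 0 ≤ C) (hs : 0 < s) (hu : 0 ≤ u) (hδ' : δ' ≤ δ)
    (hv : v ≤ C * s ^ p * Real.exp (-(δ * s⁻¹ * u))) : v ≤ C * s ^ p * Real.exp (-(δ' * s⁻¹ * u)) := by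
  refine hv.trans (mul_le_mul_of_nonneg_left ?_ (mul_nonneg hC (Real.rpow_pos_of_pos hs _).le))
  rw [Real.exp_le_exp, neg_le_neg_iff]
  exact mul_le_mul_of_nonneg_right (mul_le_mul_of_nonneg_right hδ' (inv_pos.mpr hs).le) hu

/-- **The (2.10)-type bounds of the zero-field torus pieces at every smaller rate**: the four clauses of
`B3Sect3KernelsZeroTorus.gpiece_bounds` (value `s^{2−d}`, one difference in the first / second variable `s^{1−d}`, mixed difference `s^{−d}`,
all `× e^{−δ′s^{−1}ε|x−x′|₁}`) hold, with the SAME constant `C`, for every rate `0 < δ′ ≤ δ` — uniformly in the volume `P` (fixed `d, L`),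
in `1 ≤ k ≤ K` and in the scale `j`. [cite: Balaban1983Higgs3, (2.10) p.426] -/
theorem gpiece_bounds_of_le (d L : ℕ) (hd : 1 ≤ d) (hL : Odd L ∧ 1 < L) {a : ℝ} (ha : 0 < a) {msq : ℝ} (hmsq : 0 ≤ msq) :
    ∃ δ C : ℝ, 0 < δ ∧ 0 < C ∧ ∀ δ' : ℝ, 0 < δ' → δ' ≤ δ → ∀ (P : Params), P.d = d → P.L = L →
      ∀ k : ℕ, 1 ≤ k → k ≤ P.K →
        (∀ (j : ℕ) (x x' : Site P 0),
          |gpiece P a msq k j x x'| ≤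
            C * P.spacing j ^ ((2 : ℝ) - (P.d : ℝ)) * Real.exp (-(δ' * (P.spacing j)⁻¹ * (P.eps * (Site.tdist x x' : ℝ))))) ∧
        (∀ (j : ℕ) (μ : Fin P.d) (x x' : Site P 0),
          |d1Kernel (P.eps)⁻¹ μ (gpiece P a msq k j) x x'| ≤
            C * P.spacing j ^ ((1 : ℝ) - (P.d : ℝ)) * Real.exp (-(δ' * (P.spacing j)⁻¹ * (P.eps * (Site.tdist x x' : ℝ))))) ∧
        (∀ (j : ℕ) (μ : Fin P.d) (y x' : Site P 0),
          |dAdjKernel (P.eps)⁻¹ μ (gpiece P a msq k j) y x'| ≤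
            C * P.spacing j ^ ((1 : ℝ) - (P.d : ℝ)) * Real.exp (-(δ' * (P.spacing j)⁻¹ * (P.eps * (Site.tdist y x' : ℝ))))) ∧
        (∀ (j : ℕ) (μ' μ : Fin P.d) (x x' : Site P 0),
          |d2Kernel (P.eps)⁻¹ μ' μ (gpiece P a msq k j) x x'| ≤
            C * P.spacing j ^ (-(P.d : ℝ)) * Real.exp (-(δ' * (P.spacing j)⁻¹ * (P.eps * (Site.tdist x x' : ℝ))))) := by
  obtain ⟨δ, C, hδ, hC, h⟩ := gpiece_bounds d L hd hL ha hmsq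
  refine ⟨δ, C, hδ, hC, ?_⟩
  intro δ' _ hδ'δ P hPd hPL k hk1 hkK
  obtain ⟨hv, hr, hc, hm⟩ := h P hPd hPL k hk1 hkK
  have hu : ∀ x x' : Site P 0, 0 ≤ P.eps * (Site.tdist x x' : ℝ) := fun x x' =>
    mul_nonneg P.eps_pos.le (Nat.cast_nonneg _)
  exact ⟨fun j x x' => relax hC.le (P.spacing_pos j) (hu x x') hδ'δ (hv j x x'),
    fun j μ x x' => relax hC.le (P.spacing_pos j) (hu x x') hδ'δ (hr j μ x x'),
    fun j μ y x' => relax hC.le (P.spacing_pos j) (hu y x') hδ'δ (hc j μ y x'),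
    fun j μ' μ x x' => relax hC.le (P.spacing_pos j) (hu x x') hδ'δ (hm j μ' μ x x')⟩

end Rates

/-! ## §2 (3.14) at the torus model instance -/

section Local314

universe u

/-- **(3.14)** p. 436 [PDF 26] FOR THE ZERO-FIELD TORUS PROPAGATOR PIECES, PROVED: there are `δ, C > 0` (functions of `d, L, a, m²`) such
that for every rate `0 < δ′ ≤ δ`, every volume `P` (these `d, L`), every `1 ≤ k ≤ K`, all scales `j, j′`, every `‖q·‖ ≤ Q‖·‖`,
localization functions `|g|, |g′| ≤ 1`, every field `φ` and every leg `φ′` obeying the LOCALIZED (2.11)-type two-point bound around `x″`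
at rate `δ′` and scale `s″ ≥ max(L^jε, L^{j′}ε)`, `s″ ≥ ε` (constant `C₃`), the expression (3.12) built on `G_{(j)} := gpiece j`,
`G_{(j′)} := gpiece j′` satisfies the printed (3.14):
`|(3.12)| ≤ 8d·C·C·C₃Q²e^{δ′/2}(2/δ′ + 8/δ′²)(m·m^α)Σ_{x,x′}ε^{2d}‖φ(x)‖(L^jε)^{−d}e^{−½δ′|x−x′|/L^jε}(L^{j′}ε)^{2−d}e^{−½δ′|x−x′|/L^{j′}ε}
e^{−½δ′|x−x″|/s″}`, `m = min(L^jε, L^{j′}ε)`, `|x−x′| = ε|x−x′|₁` — `B3Ineq314Local.abs_term312_le_local` with its kernel hypotheses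
`hGj` (mixed difference, degree −d) and `hGj′` (value, degree −d+2) DISCHARGED by `gpiece_bounds_of_le`.
[cite: Balaban1983Higgs3, (3.14) p.436] -/
theorem abs_term312_le_local_zeroTorus (d L : ℕ) (hd : 1 ≤ d) (hL : Odd L ∧ 1 < L) {a : ℝ} (ha : 0 < a) {msq : ℝ}
    (hmsq : 0 ≤ msq) :
    ∃ δ C : ℝ, 0 < δ ∧ 0 < C ∧ ∀ δ' : ℝ, 0 < δ' → δ' ≤ δ → ∀ (P : Params), P.d = d → P.L = L →
      ∀ k : ℕ, 1 ≤ k → k ≤ P.K → ∀ (j j' : ℕ)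
        {W : Type u} [NormedAddCommGroup W] [InnerProductSpace ℝ W]
        {α Q C₃ s'' : ℝ}, 0 ≤ α → α ≤ 1 → 0 ≤ Q → 0 ≤ C₃ → max (P.spacing j) (P.spacing j') ≤ s'' → P.eps ≤ s'' →
        ∀ (q : W →ₗ[ℝ] W), (∀ w : W, ‖q w‖ ≤ Q * ‖w‖) →
        ∀ (g g' : SiteField P 0 ℝ), (∀ x, |g x| ≤ 1) → (∀ x, |g' x| ≤ 1) →
        ∀ (φ φ' : SiteField P 0 W) (x'' : Site P 0),
          (∀ (μ : Fin P.d) (z z' : Site P 0), ‖pdiff (P.eps)⁻¹ μ φ' z - pdiff (P.eps)⁻¹ μ φ' z'‖ ≤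
            C₃ * (P.eps * Site.tdist z z') ^ α *
              Real.exp (-(δ' * s''⁻¹ * (P.eps * ((min (Site.tdist z x'') (Site.tdist z' x'') : ℕ) : ℝ))))) →
          |term312 P.eps q (gpiece P a msq k j) (gpiece P a msq k j') g g' φ φ'| ≤
            8 * P.d * C * C * C₃ * Q ^ 2 * Real.exp (δ' / 2) * (2 / δ' + 8 / δ' ^ 2) *
              (min (P.spacing j) (P.spacing j') * (min (P.spacing j) (P.spacing j')) ^ α) *
              ∑ x : Site P 0, ∑ x' : Site P 0, P.eps ^ (2 * P.d) *
                (‖φ x‖ * (P.spacing j ^ (-(P.d : ℝ)) *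
                    Real.exp (-(δ' / 2 * (P.spacing j)⁻¹ * (P.eps * Site.tdist x x'))))
                  * (P.spacing j' ^ ((2 : ℝ) - (P.d : ℝ)) *
                    Real.exp (-(δ' / 2 * (P.spacing j')⁻¹ * (P.eps * Site.tdist x x'))))
                  * Real.exp (-(δ' / 2 * s''⁻¹ * (P.eps * Site.tdist x x'')))) := by
  obtain ⟨δ, C, hδ, hC, h⟩ := gpiece_bounds_of_le d L hd hL ha hmsq
  refine ⟨δ, C, hδ, hC, ?_⟩
  intro δ' hδ' hδ'δ P hPd hPL k hk1 hkK j j' W _ _ α Q C₃ s'' hα0 hα1 hQ hC₃ hss hηs q hq g g' hg hg' φ φ' x'' hleg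
  obtain ⟨hv, -, -, hmix⟩ := h δ' hδ' hδ'δ P hPd hPL k hk1 hkK
  exact abs_term312_le_local P.eps P.eps_pos hα0 hα1 hQ hC₃ hδ' (P.spacing_pos j) (P.spacing_pos j') hss hηs q hq _ _ g g'
    hg hg' (fun μ x x' => hmix j μ μ x x') (hv j') φ φ' x'' hleg

end Local314

/-! ## §3 The last curly bracket of (3.26) at the torus model instance -/

section Curly326

/-- **p. 440 [PDF 30], the last curly bracket of (3.26), FOR THE ZERO-FIELD TORUS PROPAGATOR PIECES**, global-Hölder form, PROVED: there
are `δ, C > 0` (functions of `d, L, a, m²`) such that for every rate `0 < δ′ ≤ δ`, every volume `P` (these `d, L`), every `1 ≤ k ≤ K`,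
all scales `j, j′`, every coupling `τ`, localization functions `|g| ≤ 1`, `g′`, vector fields `A, A′` with the Hölder hypothesis
`‖∂^ε_ν(g′A′_{μ′})(z) − ∂^ε_ν(g′A′_{μ′})(z′)‖ ≤ H|z − z′|^α` on every leg function, the last curly bracket of (3.26) built on
`G_{(j)} := gpiece j`, `G_{(j′)} := gpiece j′` (with the (3.10) remainder `remFwd` of the legs) satisfies
`|curly2| ≤ 2d|τ|H(2/δ′ + 8/δ′²)(C²s^{1−d}s′^{1−d} + C²s^{2−d}s′^{−d})(m·m^α)Σ_{x,x′}ε^{2d}(Σ_μ|A_μ(x)|)e^{−½δ′|x−x′|/s}e^{−½δ′|x−x′|/s′}`,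
`s = L^jε`, `s′ = L^{j′}ε`, `m = min(s,s′)` — `B3Ineq326Curly.abs_curly2_le` with its four kernel hypotheses DISCHARGED (`hA`: difference in
the second variable of `G_{(j)}`; `hA′`, `hB′`: difference in the second variable / mixed difference of `G_{(j′)}` at swapped arguments, by
the symmetry of `|x−x′|₁`; `hB`: value of `G_{(j)}`). [cite: Balaban1983Higgs3, (3.26) p.440] -/
theorem abs_curly2_le_zeroTorus (d L : ℕ) (hd : 1 ≤ d) (hL : Odd L ∧ 1 < L) {a : ℝ} (ha : 0 < a) {msq : ℝ} (hmsq : 0 ≤ msq) :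
    ∃ δ C : ℝ, 0 < δ ∧ 0 < C ∧ ∀ δ' : ℝ, 0 < δ' → δ' ≤ δ → ∀ (P : Params), P.d = d → P.L = L →
      ∀ k : ℕ, 1 ≤ k → k ≤ P.K → ∀ (j j' : ℕ) {α H : ℝ} (τ : ℝ), 0 ≤ α → α ≤ 1 → 0 ≤ H →
        ∀ (g : SiteField P 0 ℝ), (∀ x, |g x| ≤ 1) →
        ∀ (A : VecField P 0 ℝ) (g' : SiteField P 0 ℝ) (A' : VecField P 0 ℝ),
          (∀ μ' : Fin P.d, HolderDeriv (P.eps)⁻¹ α H (legFn g' A' μ')) →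
          |curly2 P.eps τ (gpiece P a msq k j) (gpiece P a msq k j') g A
              (fun μ' x x' => remFwd (P.eps)⁻¹ (legFn g' A' μ') x x')| ≤
            2 * P.d * |τ| * H * (2 / δ' + 8 / δ' ^ 2) *
              (C * C * (P.spacing j ^ (1 - (P.d : ℝ)) * P.spacing j' ^ (1 - (P.d : ℝ))) +
                C * C * (P.spacing j ^ (2 - (P.d : ℝ)) * P.spacing j' ^ (-(P.d : ℝ)))) *
              (min (P.spacing j) (P.spacing j') * (min (P.spacing j) (P.spacing j')) ^ α) *
              ∑ x : Site P 0, ∑ x' : Site P 0, P.eps ^ (2 * P.d) *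
                ((∑ μ : Fin P.d, |A ⟨x, μ⟩|) *
                  (Real.exp (-(δ' / 2 * (P.spacing j)⁻¹ * (P.eps * Site.tdist x x'))) *
                    Real.exp (-(δ' / 2 * (P.spacing j')⁻¹ * (P.eps * Site.tdist x x'))))) := by
  obtain ⟨δ, C, hδ, hC, h⟩ := gpiece_bounds_of_le d L hd hL ha hmsq
  refine ⟨δ, C, hδ, hC, ?_⟩
  intro δ' hδ' hδ'δ P hPd hPL k hk1 hkK j j' α H τ hα0 hα1 hH g hg A g' A' hφ'
  obtain ⟨hv, -, hcol, hmix⟩ := h δ' hδ' hδ'δ P hPd hPL k hk1 hkK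
  refine abs_curly2_le P.eps P.eps_pos hα0 hα1 hH hδ' (P.spacing_pos j) (P.spacing_pos j') _ _ g hg A g' A'
    (fun μ' x x' => hcol j μ' x x') (fun μ x x' => ?_) (hv j) (fun μ μ' x x' => ?_) hφ'
  · rw [tdist_comm x x']; exact hcol j' μ x' x
  · rw [tdist_comm x x']; exact hmix j' μ' μ x' x

/-- **p. 440 [PDF 30], the last curly bracket of (3.26), FOR THE ZERO-FIELD TORUS PROPAGATOR PIECES**, LOCALIZED form (as (3.14)),
PROVED: as `abs_curly2_le_zeroTorus`, with the global Hölder hypothesis replaced by the localized (2.11)-type two-point bound on every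
differentiated leg function around the position `x″` of the second leg of its propagator (rate `δ′`, scale `s″ ≥ max(s,s′)`, `s″ ≥ ε`,
constant `C₅`):
`|curly2| ≤ 8d|τ|C₅e^{δ′/2}(2/δ′ + 8/δ′²)(C²s^{1−d}s′^{1−d} + C²s^{2−d}s′^{−d})(m·m^α)Σ_{x,x′}ε^{2d}(Σ_μ|A_μ(x)|)e^{−½δ′|x−x′|/s}
e^{−½δ′|x−x′|/s′}e^{−½δ′|x−x″|/s″}` — `B3Ineq326CurlyLocal.abs_curly2_le_local` with its four kernel hypotheses DISCHARGED.
[cite: Balaban1983Higgs3, (3.26) p.440] -/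
theorem abs_curly2_le_local_zeroTorus (d L : ℕ) (hd : 1 ≤ d) (hL : Odd L ∧ 1 < L) {a : ℝ} (ha : 0 < a) {msq : ℝ}
    (hmsq : 0 ≤ msq) :
    ∃ δ C : ℝ, 0 < δ ∧ 0 < C ∧ ∀ δ' : ℝ, 0 < δ' → δ' ≤ δ → ∀ (P : Params), P.d = d → P.L = L →
      ∀ k : ℕ, 1 ≤ k → k ≤ P.K → ∀ (j j' : ℕ) {α C₅ s'' : ℝ} (τ : ℝ), 0 ≤ α → α ≤ 1 → 0 ≤ C₅ →
        max (P.spacing j) (P.spacing j') ≤ s'' → P.eps ≤ s'' →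
        ∀ (g : SiteField P 0 ℝ), (∀ x, |g x| ≤ 1) →
        ∀ (A : VecField P 0 ℝ) (g' : SiteField P 0 ℝ) (A' : VecField P 0 ℝ) (x'' : Site P 0),
          (∀ (μ' ν : Fin P.d) (z z' : Site P 0),
            ‖pdiff (P.eps)⁻¹ ν (legFn g' A' μ') z - pdiff (P.eps)⁻¹ ν (legFn g' A' μ') z'‖ ≤
              C₅ * (P.eps * Site.tdist z z') ^ α *
                Real.exp (-(δ' * s''⁻¹ * (P.eps * ((min (Site.tdist z x'') (Site.tdist z' x'') : ℕ) : ℝ))))) →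
          |curly2 P.eps τ (gpiece P a msq k j) (gpiece P a msq k j') g A
              (fun μ' x x' => remFwd (P.eps)⁻¹ (legFn g' A' μ') x x')| ≤
            8 * P.d * |τ| * C₅ * Real.exp (δ' / 2) * (2 / δ' + 8 / δ' ^ 2) *
              (C * C * (P.spacing j ^ (1 - (P.d : ℝ)) * P.spacing j' ^ (1 - (P.d : ℝ))) +
                C * C * (P.spacing j ^ (2 - (P.d : ℝ)) * P.spacing j' ^ (-(P.d : ℝ)))) *
              (min (P.spacing j) (P.spacing j') * (min (P.spacing j) (P.spacing j')) ^ α) *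
              ∑ x : Site P 0, ∑ x' : Site P 0, P.eps ^ (2 * P.d) *
                ((∑ μ : Fin P.d, |A ⟨x, μ⟩|) *
                  (Real.exp (-(δ' / 2 * (P.spacing j)⁻¹ * (P.eps * Site.tdist x x'))) *
                    Real.exp (-(δ' / 2 * (P.spacing j')⁻¹ * (P.eps * Site.tdist x x')))) *
                  Real.exp (-(δ' / 2 * s''⁻¹ * (P.eps * Site.tdist x x'')))) := by
  obtain ⟨δ, C, hδ, hC, h⟩ := gpiece_bounds_of_le d L hd hL ha hmsq
  refine ⟨δ, C, hδ, hC, ?_⟩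
  intro δ' hδ' hδ'δ P hPd hPL k hk1 hkK j j' α C₅ s'' τ hα0 hα1 hC₅ hss hηs g hg A g' A' x'' hleg
  obtain ⟨hv, -, hcol, hmix⟩ := h δ' hδ' hδ'δ P hPd hPL k hk1 hkK
  refine abs_curly2_le_local P.eps P.eps_pos hα0 hα1 hC₅ hδ' (P.spacing_pos j) (P.spacing_pos j') hss hηs _ _ g hg A g' A'
    (fun μ' x x' => hcol j μ' x x') (fun μ x x' => ?_) (hv j) (fun μ μ' x x' => ?_) x'' hleg
  · rw [tdist_comm x x']; exact hcol j' μ x' x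
  · rw [tdist_comm x x']; exact hmix j' μ' μ x' x

/-- **p. 440 [PDF 30], the last curly bracket of (3.26) IN THE DISPLAYED (CUBE-LOCALIZED) FORM of (3.13), FOR THE ZERO-FIELD TORUS
PROPAGATOR PIECES**, PROVED: as `abs_curly2_le_zeroTorus`, with the weight localized into cubes of side `M ≥ 1` lattice units
(`(Mε)^{2d}·sup_{x∈Δ(v)}Σ_μ|A_μ(x)|·e^{−½δ′ε·dist(Δ(v),Δ(v′))/s}e^{−½δ′ε·dist(Δ(v),Δ(v′))/s′}` summed over pairs of cubes) —
`B3Ineq326CurlyCubes.abs_curly2_le_cubes` with its four kernel hypotheses DISCHARGED. [cite: Balaban1983Higgs3, (3.26) p.440] -/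
theorem abs_curly2_le_cubes_zeroTorus (d L : ℕ) (hd : 1 ≤ d) (hL : Odd L ∧ 1 < L) {a : ℝ} (ha : 0 < a) {msq : ℝ}
    (hmsq : 0 ≤ msq) :
    ∃ δ C : ℝ, 0 < δ ∧ 0 < C ∧ ∀ δ' : ℝ, 0 < δ' → δ' ≤ δ → ∀ (P : Params), P.d = d → P.L = L →
      ∀ k : ℕ, 1 ≤ k → k ≤ P.K → ∀ (j j' : ℕ) {α H : ℝ} (τ : ℝ), 0 ≤ α → α ≤ 1 → 0 ≤ H →
        ∀ (g : SiteField P 0 ℝ), (∀ x, |g x| ≤ 1) →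
        ∀ (A : VecField P 0 ℝ) (g' : SiteField P 0 ℝ) (A' : VecField P 0 ℝ),
          (∀ μ' : Fin P.d, HolderDeriv (P.eps)⁻¹ α H (legFn g' A' μ')) → ∀ {M : ℕ}, 0 < M →
          |curly2 P.eps τ (gpiece P a msq k j) (gpiece P a msq k j') g A
              (fun μ' x x' => remFwd (P.eps)⁻¹ (legFn g' A' μ') x x')| ≤
            2 * P.d * |τ| * H * (2 / δ' + 8 / δ' ^ 2) *
              (C * C * (P.spacing j ^ (1 - (P.d : ℝ)) * P.spacing j' ^ (1 - (P.d : ℝ))) +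
                C * C * (P.spacing j ^ (2 - (P.d : ℝ)) * P.spacing j' ^ (-(P.d : ℝ)))) *
              (min (P.spacing j) (P.spacing j') * (min (P.spacing j) (P.spacing j')) ^ α) *
              ∑ c ∈ cubes P 0 M, ∑ c' ∈ cubes P 0 M, ((M : ℝ) * P.eps) ^ (2 * P.d) *
                (supOn (fiber M c : Finset (Site P 0)) (fun x => ∑ μ : Fin P.d, |A ⟨x, μ⟩|) *
                  (Real.exp (-(δ' / 2 * (P.spacing j)⁻¹ * (P.eps * (cdist P 0 M M c c' : ℝ)))) *
                    Real.exp (-(δ' / 2 * (P.spacing j')⁻¹ * (P.eps * (cdist P 0 M M c c' : ℝ)))))) := by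
  obtain ⟨δ, C, hδ, hC, h⟩ := gpiece_bounds_of_le d L hd hL ha hmsq
  refine ⟨δ, C, hδ, hC, ?_⟩
  intro δ' hδ' hδ'δ P hPd hPL k hk1 hkK j j' α H τ hα0 hα1 hH g hg A g' A' hφ' M hM
  obtain ⟨hv, -, hcol, hmix⟩ := h δ' hδ' hδ'δ P hPd hPL k hk1 hkK
  refine abs_curly2_le_cubes P.eps P.eps_pos hα0 hα1 hH hδ' (P.spacing_pos j) (P.spacing_pos j') _ _ g hg A g' A'
    (fun μ' x x' => hcol j μ' x x') (fun μ x x' => ?_) (hv j) (fun μ μ' x x' => ?_) hφ' hM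
  · rw [tdist_comm x x']; exact hcol j' μ x' x
  · rw [tdist_comm x x']; exact hmix j' μ' μ x' x

end Curly326

/-! ## §4 (3.13) in its displayed cube form at the torus model instance -/

section Cubes313

universe u

/-- **(3.13)** p. 436 [PDF 26] IN ITS DISPLAYED (CUBE-LOCALIZED) FORM, FOR THE ZERO-FIELD TORUS PROPAGATOR PIECES, PROVED: there are
`δ, C > 0` (functions of `d, L, a, m²`) such that for every rate `0 < δ′ ≤ δ`, every volume `P` (these `d, L`), every `1 ≤ k ≤ K`, all
scales `j, j′`, every cube side `M ≥ 1` (lattice units; the print takes `|Δ(v)| = (L^{j₁}η)^d`, i.e. `M = L^{j₁}`), every `‖q·‖ ≤ Q‖·‖`,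
localization functions `|g|, |g′| ≤ 1`, every field `φ` and Hölder leg `φ′` (`‖∂^εφ′(z) − ∂^εφ′(z′)‖ ≤ H|z−z′|^α`), the expression (3.12)
built on `G_{(j)} := gpiece j`, `G_{(j′)} := gpiece j′` satisfies
`|(3.12)| ≤ 2d·C·C·Q²H(2/δ′ + 8/δ′²)(m·m^α)·Σ_{Δ(v),Δ(v′)} (Mε)^{2d} sup_{x∈Δ(v)}‖φ(x)‖·(L^jε)^{−d}e^{−½δ′ε·dist(Δ(v),Δ(v′))/L^jε}
(L^{j′}ε)^{2−d}e^{−½δ′ε·dist(Δ(v),Δ(v′))/L^{j′}ε}` — `B3Ineq314Cubes.abs_term312_le_cubes` with its kernel hypotheses DISCHARGED by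
`gpiece_bounds_of_le` (cubes `cubes P 0 M`, fibres `fiber M c`, cube distance `cdist` in lattice units).
[cite: Balaban1983Higgs3, (3.13) p.436] -/
theorem abs_term312_le_cubes_zeroTorus (d L : ℕ) (hd : 1 ≤ d) (hL : Odd L ∧ 1 < L) {a : ℝ} (ha : 0 < a) {msq : ℝ}
    (hmsq : 0 ≤ msq) :
    ∃ δ C : ℝ, 0 < δ ∧ 0 < C ∧ ∀ δ' : ℝ, 0 < δ' → δ' ≤ δ → ∀ (P : Params), P.d = d → P.L = L →
      ∀ k : ℕ, 1 ≤ k → k ≤ P.K → ∀ (j j' : ℕ)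
        {W : Type u} [NormedAddCommGroup W] [InnerProductSpace ℝ W]
        {α H Q : ℝ}, 0 ≤ α → α ≤ 1 → 0 ≤ H → 0 ≤ Q →
        ∀ (q : W →ₗ[ℝ] W), (∀ w : W, ‖q w‖ ≤ Q * ‖w‖) →
        ∀ (g g' : SiteField P 0 ℝ), (∀ x, |g x| ≤ 1) → (∀ x, |g' x| ≤ 1) →
        ∀ (φ φ' : SiteField P 0 W), HolderDeriv (P.eps)⁻¹ α H φ' → ∀ {M : ℕ}, 0 < M →
          |term312 P.eps q (gpiece P a msq k j) (gpiece P a msq k j') g g' φ φ'| ≤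
            2 * P.d * C * C * Q ^ 2 * H * (2 / δ' + 8 / δ' ^ 2) *
              (min (P.spacing j) (P.spacing j') * (min (P.spacing j) (P.spacing j')) ^ α) *
              ∑ c ∈ cubes P 0 M, ∑ c' ∈ cubes P 0 M, ((M : ℝ) * P.eps) ^ (2 * P.d) *
                (supOn (fiber M c : Finset (Site P 0)) (fun x => ‖φ x‖) *
                  ((P.spacing j ^ (-(P.d : ℝ)) *
                      Real.exp (-(δ' / 2 * (P.spacing j)⁻¹ * (P.eps * (cdist P 0 M M c c' : ℝ))))) *
                    (P.spacing j' ^ ((2 : ℝ) - (P.d : ℝ)) *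
                      Real.exp (-(δ' / 2 * (P.spacing j')⁻¹ * (P.eps * (cdist P 0 M M c c' : ℝ))))))) := by
  obtain ⟨δ, C, hδ, hC, h⟩ := gpiece_bounds_of_le d L hd hL ha hmsq
  refine ⟨δ, C, hδ, hC, ?_⟩
  intro δ' hδ' hδ'δ P hPd hPL k hk1 hkK j j' W _ _ α H Q hα0 hα1 hH hQ q hq g g' hg hg' φ φ' hφ' M hM
  obtain ⟨hv, -, -, hmix⟩ := h δ' hδ' hδ'δ P hPd hPL k hk1 hkK
  exact abs_term312_le_cubes P.eps P.eps_pos hα0 hα1 hH hQ hδ' (P.spacing_pos j) (P.spacing_pos j') q hq _ _ g g' hg hg'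
    (fun μ x x' => hmix j μ μ x x') (hv j') φ φ' hφ' hM

end Cubes313

end

end Literature.MathematicalPhysics.QuantumFieldTheory.Balaban1983to89.B3Sect3EstimatesZeroTorus
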